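import Summits.Ventures.LatticeQCDFlow.Scoring.WilsonFlowRK3Consistency
import HarnessLib

/-!
# The RK3 integrator of the Wilson flow is smooth in the step size and the field, and its one-step error is `o(ε)` UNIFORMLY over all configurations

HONEST FRAMING: exact (Metropolis-corrected) sampling algorithms for lattice gauge theory;
figures of merit are autocorrelation/cost numbers at stated couplings and volumes; no
continuum-physics claim.

Venture `LatticeQCDFlow` (cell pub-lqcd), sub-topic `Scoring`; FANOUT row 16 (`su2-base`: the flowed clover
charge `Q` and `t²E` are measured on `RK3_ε^m V`, `m ε = t`, with `RK3_ε = Scoring/WilsonFlowRK3.wilsonFlowRK3 ε`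
the engine's `lc_flow_rk3_step`).  NEW WORK of the cell (placement rule); second file of the RK3-CONVERGENCE
packet (`Scoring/OneStepMethodConvergence` = the abstract Lax theorem; sequel `Scoring/WilsonFlowRK3Convergence`
= the instance).  Over the Literature Wilson flow (`QuantumFieldTheory/WilsonFlow`: the ambient space
`AmbConfig d L n = Edge → M_n(ℂ)` with the Frobenius norm, `WilsonFlow.coeConfig`, `loopSumAmb`, `vfAmb`,
`contDiff_suProj`, `contDiff_loopSumAmb`, the ambient ODE `hasDerivAt_coeConfig_of_isWilsonFlowLine`,
`continuous_wilsonFlow_uncurry`) and gen-4's integrator files (`WilsonFlowRK3`: `rkRegister`, `rkPush`,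
`wilsonFlowRK3`, `wilsonFlowRK3_zero`; `WilsonFlowRK3Consistency`: `hasDerivAt_wilsonFlowRK3_zero`).  Nothing is
cited as a fact; no number.  Printed counterpart, NAMED ONLY: Lüscher, JHEP 08 (2010) 071, App. C.

`WilsonFlowRK3Consistency` proved the one-step error `RK3_ε(V) − wilsonFlow ε V = o(ε)` for EACH configuration
`V` separately and listed the global convergence as NOT CLAIMED "(needs Lipschitz control of `Z` along the
scheme)".  The abstract theorem needs the local error UNIFORMLY in `V`; this file supplies it, by smoothness and
compactness instead of Lipschitz bookkeeping.

## What is here (every `d`, `n`, `L ≥ 1`)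

* §1 the AMBIENT copy of the scheme on `AmbConfig d L n` — `genAmb W e = −P(Ω_e(W))` (the tree's
  `wilsonGenerator 0`), `rkRegisterAmb`, `rkPushAmb` (`e^{X(e)} W(e)` with the matrix exponential), `rk3Amb ε` —
  and the dictionary `coeConfig (wilsonFlowRK3 ε V) = rk3Amb ε (coeConfig V)` (`coeConfig_wilsonFlowRK3`).
* §2 **`contDiff_rk3Amb`**: `(ε, W) ↦ rk3Amb ε W` is `C^m` for every `m` (polynomial loop sums, the smooth
  projection `P`, the analytic matrix exponential `NormedSpace.exp_analytic`); hence the step-size derivative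
  `rk3AmbDeriv ε W = D(rk3Amb)(ε, W)·(1, 0)` exists everywhere (`hasDerivAt_rk3Amb`), is JOINTLY CONTINUOUS
  (`continuous_rk3AmbDeriv`), and equals the flow vector field at `ε = 0` on `SU(n)` configurations
  (`rk3AmbDeriv_zero_coeConfig`, from `hasDerivAt_wilsonFlowRK3_zero` by uniqueness of derivatives).
* §3 the LOCAL ERROR `ε ↦ coeConfig (RK3_ε V) − coeConfig (wilsonFlow ε V)`: it vanishes at `ε = 0`, has the
  jointly continuous derivative `rk3LocalErrDeriv ε V = rk3AmbDeriv ε V − vfAmb (wilsonFlow ε V)`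
  (`hasDerivAt_rk3LocalErr`, `continuous_rk3LocalErrDeriv`), which VANISHES at `ε = 0` for every `V`
  (`rk3LocalErrDeriv_zero`); compactness of `SU(n)^E` (`IsCompact.eventually_forall_of_forall_eventually`) and
  the mean value inequality then give **`rk3_uniform_consistency`**: for every `η > 0`, for all sufficiently small
  `ε > 0` and EVERY configuration `V`, `‖RK3_ε(V) − wilsonFlow ε V‖ ≤ η ε` (Frobenius/sup norm of the ambient
  space) — the consistency hypothesis of `oneStep_tendstoUniformlyOn_iterate` with `K` = all of `SU(n)^E`.

NOT here: the ORDER of the local error (the printed `O(ε⁴)` needs the third-order Lie-series bookkeeping; only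
`o(ε)` uniformly is proved, which is what convergence needs); the global theorem (sequel); any number.
-/

namespace Summit.Ventures.LatticeQCDFlow.Scoring

open Matrix Filter Topology Set Literature.MathematicalPhysics.QuantumFieldTheory
open Literature.MathematicalPhysics.QuantumFieldTheory.Luscher2010 (AmbConfig)

open scoped Matrix.Norms.Frobenius

-- The scoped Frobenius instances are definitionally the product structures, but only at default transparency
-- (as in Mathlib's `MatrixExponential` and `Scoring/WilsonFlowRK3Consistency`).
set_option backward.isDefEq.respectTransparency false

variable {d L n : ℕ}

/-! ## §1 The scheme in the ambient matrix space -/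

section Ambient

/-- The ambient generator `Z(W)(e) = −P(Ω_e(W))` of a matrix-valued configuration (the tree's
`wilsonGenerator 0 W e`; on `SU(n)` configurations it is gen-4's `flowGen`, `coe_flowGen_coeConfig`). -/
noncomputable def genAmb (W : AmbConfig d L n) (e : Edge d L) : Matrix (Fin n) (Fin n) ℂ :=
  -suProj (WilsonFlow.loopSumAmb W e.1 e.2)

/-- On `SU(n)` configurations the ambient generator is `flowGen`. -/
theorem genAmb_coeConfig (V : GaugeConfig d L (Matrix.specialUnitaryGroup (Fin n) ℂ)) (e : Edge d L) :
    genAmb (WilsonFlow.coeConfig V) e = ((flowGen V e : suAlgebra n) : Matrix (Fin n) (Fin n) ℂ) := by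
  rw [genAmb, coe_flowGen, WilsonFlow.loopSumAmb_coeConfig]

/-- Ambient register update `X'(e) = aε · Z(W)(e) + b · X(e)`. -/
noncomputable def rkRegisterAmb (a b ε : ℝ) (X W : AmbConfig d L n) : AmbConfig d L n :=
  fun e => (a * ε) • genAmb W e + b • X e

/-- Ambient exponential push `W'(e) = e^{X(e)} W(e)`. -/
noncomputable def rkPushAmb (X W : AmbConfig d L n) : AmbConfig d L n :=
  fun e => NormedSpace.exp (X e) * W e

/-- The ambient copy of Lüscher's scheme: the same three stages `(¼, 0), (8/9, −17/9), (¾, −1)` as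
`wilsonFlowRK3`, with the matrix exponential in place of `expSU`. -/
noncomputable def rk3Amb (ε : ℝ) (W : AmbConfig d L n) : AmbConfig d L n :=
  let X₁ := rkRegisterAmb (1 / 4) 0 ε 0 W
  let W₁ := rkPushAmb X₁ W
  let X₂ := rkRegisterAmb (8 / 9) (-17 / 9) ε X₁ W₁
  let W₂ := rkPushAmb X₂ W₁
  let X₃ := rkRegisterAmb (3 / 4) (-1) ε X₂ W₂
  rkPushAmb X₃ W₂

/-- Dictionary for registers: reading an `𝔰𝔲(n)`-register update in the ambient space. -/
theorem coe_rkRegister (a b ε : ℝ) (X : Edge d L → suAlgebra n)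
    (W : GaugeConfig d L (Matrix.specialUnitaryGroup (Fin n) ℂ)) :
    (fun e => ((rkRegister a b ε X W e : suAlgebra n) : Matrix (Fin n) (Fin n) ℂ)) =
      rkRegisterAmb a b ε (fun e => ((X e : suAlgebra n) : Matrix (Fin n) (Fin n) ℂ)) (WilsonFlow.coeConfig W) := by
  funext e
  simp only [rkRegister, rkRegisterAmb, Submodule.coe_add, Submodule.coe_smul, genAmb_coeConfig]

/-- Dictionary for pushes: `coeConfig (rkPush X W) = rkPushAmb X (coeConfig W)`. -/
theorem coeConfig_rkPush (X : Edge d L → suAlgebra n) (W : GaugeConfig d L (Matrix.specialUnitaryGroup (Fin n) ℂ)) :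
    WilsonFlow.coeConfig (rkPush X W) =
      rkPushAmb (fun e => ((X e : suAlgebra n) : Matrix (Fin n) (Fin n) ℂ)) (WilsonFlow.coeConfig W) := by
  funext e
  simp only [WilsonFlow.coeConfig_apply, rkPush, rkPushAmb, WilsonFlow.coe_mul_SU, coe_expSU]

/-- **Dictionary**: the engine's step read in the ambient space is the ambient scheme,
`coeConfig (RK3_ε V) = rk3Amb ε (coeConfig V)`. -/
theorem coeConfig_wilsonFlowRK3 (ε : ℝ) (V : GaugeConfig d L (Matrix.specialUnitaryGroup (Fin n) ℂ)) :
    WilsonFlow.coeConfig (wilsonFlowRK3 ε V) = rk3Amb ε (WilsonFlow.coeConfig V) := by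
  have h0 : (fun _ : Edge d L => ((0 : suAlgebra n) : Matrix (Fin n) (Fin n) ℂ)) = (0 : AmbConfig d L n) := by
    funext e
    rfl
  simp only [wilsonFlowRK3, rk3Amb, coeConfig_rkPush, coe_rkRegister, h0]

/-- The ambient scheme at step size `0` is the identity. -/
@[simp] theorem rk3Amb_zero (W : AmbConfig d L n) : rk3Amb 0 W = W := by
  have hreg : ∀ (a b : ℝ) (W' : AmbConfig d L n), rkRegisterAmb a b 0 0 W' = 0 := by
    intro a b W'
    funext e
    simp [rkRegisterAmb]
  have hpush : ∀ W' : AmbConfig d L n, rkPushAmb 0 W' = W' := by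
    intro W'
    funext e
    simp [rkPushAmb]
  simp only [rk3Amb, hreg, hpush]

end Ambient

/-! ## §2 Smoothness in the step size and the field -/

section Smooth

variable [NeZero L]

/-- The matrix exponential is `C^m` for every `m` (it is analytic, `NormedSpace.exp_analytic`). -/
theorem contDiff_matrixExp {m : WithTop ℕ∞} :
    ContDiff ℝ m (NormedSpace.exp : Matrix (Fin n) (Fin n) ℂ → Matrix (Fin n) (Fin n) ℂ) :=
  contDiff_iff_contDiffAt.2 fun x => (NormedSpace.exp_analytic (𝕂 := ℝ) x).contDiffAt

/-- The ambient generator at a link is a `C^m` function of the configuration. -/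
theorem contDiff_genAmb {m : WithTop ℕ∞} (e : Edge d L) :
    ContDiff ℝ m (fun W : AmbConfig d L n => genAmb W e) :=
  (WilsonFlow.contDiff_suProj.comp (WilsonFlow.contDiff_loopSumAmb e.1 e.2)).neg

/-- A register update is `C^m` jointly in (step size, previous register, field) along `C^m` families. -/
theorem contDiff_rkRegisterAmb {m : WithTop ℕ∞} {P : Type*} [NormedAddCommGroup P] [NormedSpace ℝ P] (a b : ℝ)
    {εf : P → ℝ} {Xf Wf : P → AmbConfig d L n} (hε : ContDiff ℝ m εf) (hX : ContDiff ℝ m Xf)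
    (hW : ContDiff ℝ m Wf) : ContDiff ℝ m fun p => rkRegisterAmb a b (εf p) (Xf p) (Wf p) := by
  refine contDiff_pi.2 fun e => ?_
  simp only [rkRegisterAmb]
  exact ((contDiff_const.mul hε).smul ((contDiff_genAmb e).comp hW)).add
    ((contDiff_pi.1 hX e).const_smul b)

/-- An exponential push is `C^m` jointly in (register, field) along `C^m` families. -/
theorem contDiff_rkPushAmb {m : WithTop ℕ∞} {P : Type*} [NormedAddCommGroup P] [NormedSpace ℝ P]
    {Xf Wf : P → AmbConfig d L n} (hX : ContDiff ℝ m Xf) (hW : ContDiff ℝ m Wf) :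
    ContDiff ℝ m fun p => rkPushAmb (Xf p) (Wf p) := by
  refine contDiff_pi.2 fun e => ?_
  simp only [rkPushAmb]
  exact (contDiff_matrixExp.comp (contDiff_pi.1 hX e)).mul (contDiff_pi.1 hW e)

/-- **The scheme is `C^m` jointly in the step size and the field**, for every `m`. -/
theorem contDiff_rk3Amb {m : WithTop ℕ∞} :
    ContDiff ℝ m fun p : ℝ × AmbConfig d L n => rk3Amb p.1 p.2 := by
  have hε : ContDiff ℝ m fun p : ℝ × AmbConfig d L n => p.1 := contDiff_fst
  have hW : ContDiff ℝ m fun p : ℝ × AmbConfig d L n => p.2 := contDiff_snd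
  have hX₁ := contDiff_rkRegisterAmb (1 / 4) 0 hε (contDiff_const (c := (0 : AmbConfig d L n))) hW
  have hW₁ := contDiff_rkPushAmb hX₁ hW
  have hX₂ := contDiff_rkRegisterAmb (8 / 9) (-17 / 9) hε hX₁ hW₁
  have hW₂ := contDiff_rkPushAmb hX₂ hW₁
  have hX₃ := contDiff_rkRegisterAmb (3 / 4) (-1) hε hX₂ hW₂
  have hW₃ := contDiff_rkPushAmb hX₃ hW₂
  simpa only [rk3Amb] using hW₃

/-- The scheme is jointly continuous in (step size, field). -/
theorem continuous_rk3Amb_uncurry : Continuous fun p : ℝ × AmbConfig d L n => rk3Amb p.1 p.2 :=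
  (contDiff_rk3Amb (m := 0)).continuous

/-- **The step-size derivative of the scheme**: `rk3AmbDeriv ε W = D(rk3Amb)(ε, W) · (1, 0)`, the partial
derivative in `ε` read off the (Fréchet) derivative of the jointly smooth map. -/
noncomputable def rk3AmbDeriv (ε : ℝ) (W : AmbConfig d L n) : AmbConfig d L n :=
  fderiv ℝ (fun p : ℝ × AmbConfig d L n => rk3Amb p.1 p.2) (ε, W) (1, 0)

/-- `ε ↦ rk3Amb ε W` has derivative `rk3AmbDeriv ε W` at every `ε` (chain rule along `ε ↦ (ε, W)`). -/
theorem hasDerivAt_rk3Amb (ε : ℝ) (W : AmbConfig d L n) :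
    HasDerivAt (fun ε : ℝ => rk3Amb ε W) (rk3AmbDeriv ε W) ε := by
  have hF : HasFDerivAt (fun p : ℝ × AmbConfig d L n => rk3Amb p.1 p.2)
      (fderiv ℝ (fun p : ℝ × AmbConfig d L n => rk3Amb p.1 p.2) (ε, W)) (ε, W) :=
    ((contDiff_rk3Amb (m := 1)).differentiable one_ne_zero (ε, W)).hasFDerivAt
  have hc : HasDerivAt (fun s : ℝ => (s, W)) ((1 : ℝ), (0 : AmbConfig d L n)) ε :=
    (hasDerivAt_id ε).prodMk (hasDerivAt_const ε W)
  exact hF.comp_hasDerivAt ε hc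

/-- **The step-size derivative is jointly continuous** in (step size, field) (`C¹` ⇒ continuous `fderiv`). -/
theorem continuous_rk3AmbDeriv : Continuous fun p : ℝ × AmbConfig d L n => rk3AmbDeriv p.1 p.2 := by
  have h := (contDiff_rk3Amb (d := d) (L := L) (n := n) (m := 1)).continuous_fderiv one_ne_zero
  exact h.clm_apply continuous_const

/-- **At `ε = 0` the step-size derivative is the flow vector field** on `SU(n)` configurations:
`rk3AmbDeriv 0 (coeConfig V) = vfAmb (coeConfig V)` — gen-4's `hasDerivAt_wilsonFlowRK3_zero`, link by link,
and uniqueness of derivatives. -/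
theorem rk3AmbDeriv_zero_coeConfig (V : GaugeConfig d L (Matrix.specialUnitaryGroup (Fin n) ℂ)) :
    rk3AmbDeriv 0 (WilsonFlow.coeConfig V) = WilsonFlow.vfAmb (WilsonFlow.coeConfig V) := by
  have h1 : HasDerivAt (fun ε : ℝ => rk3Amb ε (WilsonFlow.coeConfig V)) (rk3AmbDeriv 0 (WilsonFlow.coeConfig V)) 0 :=
    hasDerivAt_rk3Amb 0 _
  have h2 : HasDerivAt (fun ε : ℝ => rk3Amb ε (WilsonFlow.coeConfig V)) (WilsonFlow.vfAmb (WilsonFlow.coeConfig V)) 0 := by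
    have h := hasDerivAt_pi.2 fun e => hasDerivAt_wilsonFlowRK3_zero V e
    have hfun : (fun ε : ℝ => fun e : Edge d L =>
        ((wilsonFlowRK3 ε V e : Matrix.specialUnitaryGroup (Fin n) ℂ) : Matrix (Fin n) (Fin n) ℂ)) =
        fun ε => rk3Amb ε (WilsonFlow.coeConfig V) := by
      funext ε
      exact coeConfig_wilsonFlowRK3 ε V
    have hvf : wilsonFlowVF V = WilsonFlow.vfAmb (WilsonFlow.coeConfig V) := by
      funext e
      exact (WilsonFlow.vfAmb_coeConfig V e).symm
    rw [hfun, hvf] at h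
    exact h
  exact h1.unique h2

end Smooth

/-! ## §3 The local error and its uniform bound -/

section LocalError

/-- The local (one-step) error of the scheme against the exact flow, read in the ambient space:
`rk3LocalErr ε V = coeConfig (RK3_ε V) − coeConfig (wilsonFlow ε V)`. -/
noncomputable def rk3LocalErr (ε : ℝ) (V : GaugeConfig d L (Matrix.specialUnitaryGroup (Fin n) ℂ)) : AmbConfig d L n :=
  WilsonFlow.coeConfig (wilsonFlowRK3 ε V) - WilsonFlow.coeConfig (wilsonFlow ε V)

/-- The local error vanishes at `ε = 0`. -/
@[simp] theorem rk3LocalErr_zero (V : GaugeConfig d L (Matrix.specialUnitaryGroup (Fin n) ℂ)) :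
    rk3LocalErr 0 V = 0 := by
  simp [rk3LocalErr, wilsonFlowRK3_zero, wilsonFlow_zero]

variable [NeZero L]

/-- The step-size derivative of the local error: `∂_ε RK3_ε(V) − Z(V_ε)V_ε` with `V_ε = wilsonFlow ε V`. -/
noncomputable def rk3LocalErrDeriv (ε : ℝ) (V : GaugeConfig d L (Matrix.specialUnitaryGroup (Fin n) ℂ)) :
    AmbConfig d L n :=
  rk3AmbDeriv ε (WilsonFlow.coeConfig V) - WilsonFlow.vfAmb (WilsonFlow.coeConfig (wilsonFlow ε V))

/-- The local error is differentiable in the step size at every `ε`, with derivative `rk3LocalErrDeriv ε V`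
(the scheme by `hasDerivAt_rk3Amb`, the exact flow by the ambient flow equation). -/
theorem hasDerivAt_rk3LocalErr (V : GaugeConfig d L (Matrix.specialUnitaryGroup (Fin n) ℂ)) (ε : ℝ) :
    HasDerivAt (fun ε : ℝ => rk3LocalErr ε V) (rk3LocalErrDeriv ε V) ε := by
  have h1 : HasDerivAt (fun ε : ℝ => WilsonFlow.coeConfig (wilsonFlowRK3 ε V)) (rk3AmbDeriv ε (WilsonFlow.coeConfig V)) ε := by
    have h := hasDerivAt_rk3Amb ε (WilsonFlow.coeConfig V)
    have hfun : (fun ε : ℝ => rk3Amb ε (WilsonFlow.coeConfig V)) = fun ε => WilsonFlow.coeConfig (wilsonFlowRK3 ε V) := by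
      funext ε
      exact (coeConfig_wilsonFlowRK3 ε V).symm
    rw [hfun] at h
    exact h
  have h2 : HasDerivAt (fun ε : ℝ => WilsonFlow.coeConfig (wilsonFlow ε V))
      (WilsonFlow.vfAmb (WilsonFlow.coeConfig (wilsonFlow ε V))) ε :=
    WilsonFlow.hasDerivAt_coeConfig_of_isWilsonFlowLine (isWilsonFlowLine_wilsonFlow V) ε
  exact h1.sub h2

/-- **The derivative of the local error is jointly continuous** in (step size, configuration). -/
theorem continuous_rk3LocalErrDeriv :
    Continuous fun p : ℝ × GaugeConfig d L (Matrix.specialUnitaryGroup (Fin n) ℂ) => rk3LocalErrDeriv p.1 p.2 := by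
  have h1 : Continuous fun p : ℝ × GaugeConfig d L (Matrix.specialUnitaryGroup (Fin n) ℂ) =>
      rk3AmbDeriv p.1 (WilsonFlow.coeConfig p.2) :=
    continuous_rk3AmbDeriv.comp (continuous_fst.prodMk (WilsonFlow.continuous_coeConfig.comp continuous_snd))
  have h2 : Continuous fun p : ℝ × GaugeConfig d L (Matrix.specialUnitaryGroup (Fin n) ℂ) =>
      WilsonFlow.vfAmb (WilsonFlow.coeConfig (wilsonFlow p.1 p.2)) :=
    (WilsonFlow.contDiff_vfAmb (m := 0)).continuous.comp
      (WilsonFlow.continuous_coeConfig.comp continuous_wilsonFlow_uncurry)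
  exact h1.sub h2

/-- **The derivative of the local error vanishes at `ε = 0`** for every configuration: both curves leave
`V` with the velocity `Z(V) V`. -/
@[simp] theorem rk3LocalErrDeriv_zero (V : GaugeConfig d L (Matrix.specialUnitaryGroup (Fin n) ℂ)) :
    rk3LocalErrDeriv 0 V = 0 := by
  rw [rk3LocalErrDeriv, rk3AmbDeriv_zero_coeConfig, wilsonFlow_zero, sub_self]

/-- **Uniform first-order consistency of the engine's integrator.**  For every `η > 0` there is `δ > 0` such
that for all `0 < ε < δ` and EVERY `SU(n)` configuration `V`,
`‖coeConfig (RK3_ε V) − coeConfig (wilsonFlow ε V)‖ ≤ η ε` (norm of the ambient configuration space): the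
local error is `o(ε)` uniformly on the compact configuration space.  This is the consistency hypothesis of
`Scoring/OneStepMethodConvergence.oneStep_tendstoUniformlyOn_iterate`. -/
theorem rk3_uniform_consistency {η : ℝ} (hη : 0 < η) :
    ∀ᶠ ε in 𝓝[>] (0 : ℝ), ∀ V : GaugeConfig d L (Matrix.specialUnitaryGroup (Fin n) ℂ),
      ‖rk3LocalErr ε V‖ ≤ η * ε := by
  -- Step 1: the derivative of the local error is uniformly small near `ε = 0` (compactness).
  have hK : IsCompact (univ : Set (GaugeConfig d L (Matrix.specialUnitaryGroup (Fin n) ℂ))) := isCompact_univ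
  have hP : ∀ V ∈ (univ : Set (GaugeConfig d L (Matrix.specialUnitaryGroup (Fin n) ℂ))),
      ∀ᶠ z : ℝ × GaugeConfig d L (Matrix.specialUnitaryGroup (Fin n) ℂ) in 𝓝 ((0 : ℝ), V),
        ‖rk3LocalErrDeriv z.1 z.2‖ < η := by
    intro V _
    have hc : ContinuousAt (fun z : ℝ × GaugeConfig d L (Matrix.specialUnitaryGroup (Fin n) ℂ) =>
        ‖rk3LocalErrDeriv z.1 z.2‖) ((0 : ℝ), V) :=
      (continuous_norm.comp continuous_rk3LocalErrDeriv).continuousAt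
    have h0 : ‖rk3LocalErrDeriv (0 : ℝ) V‖ < η := by
      rw [rk3LocalErrDeriv_zero, norm_zero]
      exact hη
    exact hc.eventually (gt_mem_nhds h0)
  have hev := hK.eventually_forall_of_forall_eventually
    (P := fun s (V : GaugeConfig d L (Matrix.specialUnitaryGroup (Fin n) ℂ)) => ‖rk3LocalErrDeriv s V‖ < η) hP
  obtain ⟨δ, hδ, hball⟩ := Metric.eventually_nhds_iff.1 hev
  -- Step 2: the mean value inequality on `[0, ε]` for `0 < ε < δ`.
  have hmem : Ioo (0 : ℝ) δ ∈ 𝓝[>] (0 : ℝ) := Ioo_mem_nhdsGT hδ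
  filter_upwards [hmem] with ε hε V
  have hderiv : ∀ s ∈ Icc (0 : ℝ) ε, HasDerivWithinAt (fun s : ℝ => rk3LocalErr s V) (rk3LocalErrDeriv s V) (Icc 0 ε) s :=
    fun s _ => (hasDerivAt_rk3LocalErr V s).hasDerivWithinAt
  have hbound : ∀ s ∈ Ico (0 : ℝ) ε, ‖rk3LocalErrDeriv s V‖ ≤ η := by
    intro s hs
    have hsδ : dist s 0 < δ := by
      rw [dist_zero_right, Real.norm_eq_abs, abs_of_nonneg hs.1]
      exact lt_trans hs.2 hε.2
    exact le_of_lt (hball hsδ V (mem_univ V))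
  have h := norm_image_sub_le_of_norm_deriv_le_segment' hderiv hbound ε ⟨le_of_lt hε.1, le_rfl⟩
  simpa only [rk3LocalErr_zero, sub_zero] using h

/-- The same bound, unfolded: `dist (coeConfig (RK3_ε V)) (coeConfig (wilsonFlow ε V)) ≤ η ε` uniformly. -/
theorem rk3_uniform_consistency_dist {η : ℝ} (hη : 0 < η) :
    ∀ᶠ ε in 𝓝[>] (0 : ℝ), ∀ V : GaugeConfig d L (Matrix.specialUnitaryGroup (Fin n) ℂ),
      dist (WilsonFlow.coeConfig (wilsonFlowRK3 ε V)) (WilsonFlow.coeConfig (wilsonFlow ε V)) ≤ η * ε := by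
  filter_upwards [rk3_uniform_consistency (d := d) (L := L) (n := n) hη] with ε hε V
  rw [dist_eq_norm]
  exact hε V

end LocalError

end Summit.Ventures.LatticeQCDFlow.Scoring
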